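import Summits.SmoothPoincare4.SmoothPoincare4.Theorems.ConvexBisectionAcyclicBisectionExistsDualHandlePlumbing
import Literature.Geometry.Symplectic.TwoHandleIsotopyAmbient
import Literature.Geometry.Symplectic.BoundaryChartImmersion
import Literature.Topology.FourManifolds.FrameAlongMap
import HarnessLib

/-!
# Dual handles, T3c: the seam push of knots and framings of `∂X` into `W`
(brick (b), part 1, of the sub-goal T3c-3 `node_dualLink_pageLink` of stub `stub_steinRealisation`
(NF6), line `modp-braid-orbits` r11, crux `ConvexBisection.AcyclicBisectionExists`, item
stmt-SmoothPoincare4-10508; wave 3, lead c5; registered sub-goal `helper_isKnotFraming_seamPush`)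

For a gluing `M = X ∪_Ψ W` the dual attaching maps of the handles of `X` live on `W`
(`dualMap`, `…DualHandlePlumbing.lean`): they are belt tubes of `∂X` pushed through the seam
diffeomorphism `G = seamDiffeo bX bW Ψ : ∂X ≅ ∂W` of the CANONICAL boundary carriers
(`BoundaryManifold.boundaryData 3 _`).  The isotopies of node T3c-1 happen in `∂X`, those of node
T3c-2 in `∂W = ∂ Base g`; this file and its sequel `…DualLinkTransport.lean` are the bridge.

* §1 calculus of the canonical boundary datum: the differential of `∂X ↪ X` is `u ↦ (0, u)`, so a
  vector `v` tangent to `∂X` (`v 0 = 0`) is the image of `tail v` (`mfderiv_incl_tail`); a family of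
  such vectors continuous into `TX` is continuous into `T∂X` after taking tails
  (`continuousOn_totalSpace_tail`: chart readings of `T∂X` are tails of those of `TX`,
  `tangentCoordChange_boundaryData_tail`); smooth maps push continuous families of tangent vectors to
  continuous families (`continuousOn_totalSpace_mfderiv`, the tangent map is continuous);
* §2 the seam push `y ↦ (G y : W)` of `∂X` into `W`: smooth, injective, with injective differential
  whose image is tangent to `∂W`; the boundary inclusion after a smooth embedding of the circle into
  `∂W` is a smooth embedding into `W` (`isSmoothEmbedding_incl_comp`, through the boundary charts of
  `W`, which are slice charts for `∂W`); hence `G` pushes knots in `∂X` (lifted to `∂X` by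
  `knotLift`) to knots in `∂W` (`isBoundaryKnot_seamPush`) and framings to framings
  (`isKnotFraming_seamPush` = `helper_isKnotFraming_seamPush`).

Everything is proved; no named facts, no `sorry`.

## References
* A. A. Kosinski, *Differential Manifolds* (1993), VI §6 and VIII, proof of (1.2). [Kosinski1993]
* J. M. Lee, *Introduction to Smooth Manifolds* (2013), Thm. 5.11, Cor. 5.30. [LeeSmoothManifolds2013]
* J. Milnor, *Lectures on the h-cobordism theorem* (1965), §3 (dual handles). [MilnorHCobordism1965]
-/

noncomputable section

-- the prescribed namespace `Summit.<P>.<Sub>.…` duplicates `SmoothPoincare4` (P = Sub)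
set_option linter.dupNamespace false

open scoped Manifold ContDiff Topology

namespace Summit.SmoothPoincare4.SmoothPoincare4.Theorems.AcyclicBisectionExists.ModpBraidOrbits

open Set Function Filter Metric Topology Bundle
open Literature.Topology.FourManifolds Literature.Topology.FourManifolds.HandleAttachingMap
  Literature.Topology.FourManifolds.BoundaryManifold Literature.Geometry.Symplectic

/-! ## §1 Calculus of the canonical boundary datum -/

section BoundaryCalculus

variable {X : Type} [TopologicalSpace X] [ChartedSpace (EuclideanHalfSpace 4) X] [IsManifold (𝓡∂ 4) ∞ X]

/-- **A vector tangent to `∂X` is the image of its tail under the differential of `∂X ↪ X`**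
(`d(incl) = (u ↦ (0, u))`, `hasMFDerivAt_incl_boundaryData`). [cite: LeeSmoothManifolds2013, Thm. 5.11] -/
theorem mfderiv_incl_tail (y : (BoundaryManifold.boundaryData 3 X).carrier)
    {v : EuclideanSpace ℝ (Fin 4)} (hv : v 0 = 0) :
    mfderiv (𝓡 3) (𝓡∂ 4) (BoundaryManifold.boundaryData 3 X).incl y (tail 3 v) = v := by
  rw [(hasMFDerivAt_incl_boundaryData (n := 3) y).mfderiv]
  show consZeroL 3 (tail 3 v) = v
  rw [consZeroL_apply]
  exact consCLE_tail_of_eq_zero 3 hv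

/-- **Families of vectors tangent to `∂X`, continuous into `TX`, are continuous into `T∂X` after
taking tails**: the chart readings of `T∂X` are the tails of the chart readings of `TX`
(`tangentCoordChange_boundaryData_tail`), and continuity into a tangent bundle is continuity of the
base map plus continuity of one chart reading near each point
(`ContinuousOn.tangentCoordChange_section`, `continuousOn_totalSpaceMk_of_tangentCoordChange`).
[cite: LeeSmoothManifolds2013, Thm. 5.11] -/
theorem continuousOn_totalSpace_tail {T : Type*} [TopologicalSpace T]
    {G : T → (BoundaryManifold.boundaryData 3 X).carrier} {σ : T → EuclideanSpace ℝ (Fin 4)}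
    {R : Set T} (hσ : ∀ t ∈ R, σ t 0 = 0)
    (h : ContinuousOn (fun t => (TotalSpace.mk' (EuclideanSpace ℝ (Fin 4))
      ((BoundaryManifold.boundaryData 3 X).incl (G t)) (σ t) : TangentBundle (𝓡∂ 4) X)) R) :
    ContinuousOn (fun t => (TotalSpace.mk' (EuclideanSpace ℝ (Fin 3)) (G t) (tail 3 (σ t)) :
      TangentBundle (𝓡 3) (BoundaryManifold.boundaryData 3 X).carrier)) R := by
  have hG : ContinuousOn G R :=
    ((BoundaryManifold.boundaryData 3 X).isSmoothEmbedding.isEmbedding.continuousOn_iff).2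
      (ContinuousOn.base_of_totalSpaceMk h)
  intro t₀ ht₀
  set x₀ := G t₀ with hx₀
  set R₀ := R ∩ G ⁻¹' (chartAt (EuclideanSpace ℝ (Fin 3)) x₀).source with hR₀
  have hR₀ : R₀ ∈ 𝓝[R] t₀ :=
    inter_mem self_mem_nhdsWithin ((hG.continuousWithinAt ht₀).preimage_mem_nhdsWithin
      ((chartAt _ x₀).open_source.mem_nhds (mem_chart_source _ x₀)))
  have hmap : MapsTo G R₀ (chartAt (EuclideanSpace ℝ (Fin 3)) x₀).source := fun t ht => ht.2
  have hmapX : MapsTo (fun t => (BoundaryManifold.boundaryData 3 X).incl (G t)) R₀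
      (chartAt (EuclideanHalfSpace 4) ((BoundaryManifold.boundaryData 3 X).incl x₀)).source :=
    fun t ht => ht.2
  have hread : ContinuousOn (fun t => tangentCoordChange (𝓡 3) (G t) x₀ (G t) (tail 3 (σ t))) R₀ := by
    have h1 := (continuous_tail 3).comp_continuousOn
      ((h.mono inter_subset_left).tangentCoordChange_section hmapX)
    refine h1.congr fun t ht => ?_
    exact tangentCoordChange_boundaryData_tail (n := 3) (G t) x₀ (hmap ht) (hσ t ht.1)
  have key := continuousOn_totalSpaceMk_of_tangentCoordChange (hG.mono inter_subset_left) hmap hread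
  have ht₀' : t₀ ∈ R₀ :=
    ⟨ht₀, show G t₀ ∈ (chartAt (EuclideanSpace ℝ (Fin 3)) x₀).source from
      mem_chart_source (EuclideanSpace ℝ (Fin 3)) x₀⟩
  exact (key.continuousWithinAt ht₀').mono_of_mem_nhdsWithin hR₀

/-- **Smooth maps push families of tangent vectors which are continuous into the tangent bundle to
families continuous into the tangent bundle** (compose with the continuous tangent map). [folklore] -/
theorem continuousOn_totalSpace_mfderiv
    {EM : Type*} [NormedAddCommGroup EM] [NormedSpace ℝ EM] {HM : Type*} [TopologicalSpace HM]
    {IM : ModelWithCorners ℝ EM HM} {M : Type*} [TopologicalSpace M] [ChartedSpace HM M]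
    [IsManifold IM ∞ M]
    {EN : Type*} [NormedAddCommGroup EN] [NormedSpace ℝ EN] {HN : Type*} [TopologicalSpace HN]
    {IN : ModelWithCorners ℝ EN HN} {N : Type*} [TopologicalSpace N] [ChartedSpace HN N]
    [IsManifold IN ∞ N] {f : M → N} (hf : ContMDiff IM IN ∞ f)
    {T : Type*} [TopologicalSpace T] {G : T → M} {σ : T → EM} {R : Set T}
    (h : ContinuousOn (fun t => (TotalSpace.mk' EM (G t) (σ t) : TangentBundle IM M)) R) :
    ContinuousOn (fun t => (TotalSpace.mk' EN (f (G t)) (mfderiv IM IN f (G t) (σ t)) :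
      TangentBundle IN N)) R := by
  have key : (fun t => (TotalSpace.mk' EN (f (G t)) (mfderiv IM IN f (G t) (σ t)) :
      TangentBundle IN N)) =
      tangentMap IM IN f ∘ fun t => (TotalSpace.mk' EM (G t) (σ t) : TangentBundle IM M) := rfl
  rw [key]
  exact (hf.continuous_tangentMap (by simp)).comp_continuousOn h

end BoundaryCalculus

/-! ## §2 The seam push of knots, framings and isotopies of `∂X` into `W` -/

section SeamPush

variable {X : Type} [TopologicalSpace X] [T2Space X] [ChartedSpace (EuclideanHalfSpace 4) X]
  [IsManifold (𝓡∂ 4) ∞ X]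
  {W : Type} [TopologicalSpace W] [ChartedSpace (EuclideanHalfSpace 4) W] [IsManifold (𝓡∂ 4) ∞ W]
  (G : (BoundaryManifold.boundaryData 3 X).carrier ≃ₘ⟮𝓡 3, 𝓡 3⟯
    (BoundaryManifold.boundaryData 3 W).carrier)

omit [T2Space X] in
/-- The seam push `y ↦ (G y : W)` is smooth. [folklore] -/
theorem contMDiff_seamPush :
    ContMDiff (𝓡 3) (𝓡∂ 4) ∞ fun y => (BoundaryManifold.boundaryData 3 W).incl (G y) :=
  (BoundaryManifold.boundaryData 3 W).isSmoothEmbedding.contMDiff.comp G.contMDiff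

omit [T2Space X] in
/-- The seam push is injective. [folklore] -/
theorem injective_seamPush :
    Injective fun y => (BoundaryManifold.boundaryData 3 W).incl (G y) :=
  (BoundaryManifold.boundaryData 3 W).injective_incl.comp G.injective

omit [T2Space X] in
/-- **The differential of the seam push** is `(0, ·) ∘ dG`. [cite: LeeSmoothManifolds2013, Thm. 5.11] -/
theorem hasMFDerivAt_seamPush (y : (BoundaryManifold.boundaryData 3 X).carrier) :
    HasMFDerivAt (𝓡 3) (𝓡∂ 4) (fun y => (BoundaryManifold.boundaryData 3 W).incl (G y)) y
      ((consZeroL 3).comp (mfderiv (𝓡 3) (𝓡 3) G y)) :=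
  (hasMFDerivAt_incl_boundaryData (n := 3) (G y)).comp y
    ((G.contMDiff y).mdifferentiableAt (by simp)).hasMFDerivAt

omit [T2Space X] in
/-- The image of the differential of the seam push is tangent to `∂W`. [folklore] -/
theorem mfderiv_seamPush_apply_zero (y : (BoundaryManifold.boundaryData 3 X).carrier)
    (v : EuclideanSpace ℝ (Fin 3)) :
    mfderiv (𝓡 3) (𝓡∂ 4) (fun y => (BoundaryManifold.boundaryData 3 W).incl (G y)) y v ∈
      {w : EuclideanSpace ℝ (Fin 4) | w 0 = 0} := by
  rw [(hasMFDerivAt_seamPush G y).mfderiv]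
  exact consZeroL_apply_zero _

omit [T2Space X] in
/-- The tail of the pushed vector is `dG` of the vector. [folklore] -/
theorem tail_mfderiv_seamPush (y : (BoundaryManifold.boundaryData 3 X).carrier)
    (v : EuclideanSpace ℝ (Fin 3)) :
    tail 3 (mfderiv (𝓡 3) (𝓡∂ 4) (fun y => (BoundaryManifold.boundaryData 3 W).incl (G y)) y v) =
      mfderiv (𝓡 3) (𝓡 3) G y v := by
  rw [(hasMFDerivAt_seamPush G y).mfderiv]
  exact tail_consZeroL _

omit [T2Space X] in
/-- The differential of the seam push is injective. [folklore] -/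
theorem injective_mfderiv_seamPush (y : (BoundaryManifold.boundaryData 3 X).carrier) :
    Injective (mfderiv (𝓡 3) (𝓡∂ 4) (fun y => (BoundaryManifold.boundaryData 3 W).incl (G y)) y) := by
  rw [(hasMFDerivAt_seamPush G y).mfderiv]
  exact consZeroL_injective.comp fun a b hab =>
    (Diffeomorph.mfderivToContinuousLinearEquiv G (by simp) y).injective hab

/-- `L3 (tail y) = y` on the boundary hyperplane `{y | y 0 = 0}`. [folklore] -/
theorem L3_tail_of_apply_zero {y : EuclideanSpace ℝ (Fin 4)} (hy : y 0 = 0) :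
    LegendrianDarboux.L3 (tail 3 y) = y := by
  have h : tail 3 y = LegendrianDarboux.proj3 y := by
    ext i
    fin_cases i <;> simp [tail]
  rw [h, LegendrianDarboux.L3_proj3 hy]

omit [T2Space X] in
/-- **The boundary inclusion after a smooth embedding of the circle into `∂W` is a smooth
embedding into `W`**: a topological embedding (composition) and an immersion into the manifold
with boundary, read through the boundary charts of `W`, which are slice charts for `∂W`
(`LegendrianDarboux.isImmersionAtOfComplement_through_chart_of_injective_mfderiv`).
[cite: LeeSmoothManifolds2013, Thm. 5.11] -/
theorem isSmoothEmbedding_incl_comp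
    {g : sphere (0 : EuclideanSpace ℝ (Fin 2)) 1 → (BoundaryManifold.boundaryData 3 W).carrier}
    (hg : Manifold.IsSmoothEmbedding (𝓡 1) (𝓡 3) ∞ g) :
    Manifold.IsSmoothEmbedding (𝓡 1) (𝓡∂ 4) ∞ fun u => (BoundaryManifold.boundaryData 3 W).incl (g u) := by
  refine ⟨⟨EuclideanSpace ℝ (Fin 3), inferInstance, inferInstance, fun u => ?_⟩,
    (BoundaryManifold.boundaryData 3 W).isSmoothEmbedding.isEmbedding.comp hg.isEmbedding⟩
  have hUo : IsOpen (g ⁻¹' (chartAt (EuclideanSpace ℝ (Fin 3)) (g u)).source) :=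
    (chartAt _ (g u)).open_source.preimage hg.contMDiff.continuous
  have huU : u ∈ g ⁻¹' (chartAt (EuclideanSpace ℝ (Fin 3)) (g u)).source :=
    mem_chart_source (EuclideanSpace ℝ (Fin 3)) (g u)
  have hgcs : ContMDiffOn (𝓡 1) 𝓘(ℝ, EuclideanSpace ℝ (Fin 3)) ∞ (extChartAt (𝓡 3) (g u) ∘ g)
      (g ⁻¹' (chartAt (EuclideanSpace ℝ (Fin 3)) (g u)).source) :=
    contMDiffOn_extChartAt.comp hg.contMDiff.contMDiffOn fun u' hu' => hu'
  have hinj : Injective (mfderiv (𝓡 1) 𝓘(ℝ, EuclideanSpace ℝ (Fin 3)) (extChartAt (𝓡 3) (g u) ∘ g) u) := by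
    have hd : MDifferentiableAt (𝓡 1) (𝓡 3) g u := (hg.contMDiff u).mdifferentiableAt (by simp)
    have he : MDifferentiableAt (𝓡 3) 𝓘(ℝ, EuclideanSpace ℝ (Fin 3)) (extChartAt (𝓡 3) (g u)) (g u) :=
      mdifferentiableAt_extChartAt (mem_chart_source _ (g u))
    rw [mfderiv_comp u he hd]
    exact (isInvertible_mfderiv_extChartAt (mem_extChartAt_source (g u))).injective.comp
      (Manifold.IsImmersionAt.mfderiv_injective (hg.isImmersion.isImmersionAt u) (by simp))
  -- the reading of `incl ∘ g` through the boundary chart of `W` at `g u`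
  have key : ∀ u' ∈ g ⁻¹' (chartAt (EuclideanSpace ℝ (Fin 3)) (g u)).source,
      0 + LegendrianDarboux.L3 ((extChartAt (𝓡 3) (g u) ∘ g) u') =
      extChartAt (𝓡∂ 4) ((BoundaryManifold.boundaryData 3 W).incl (g u))
        ((BoundaryManifold.boundaryData 3 W).incl (g u')) := by
    intro u' hu'
    have hu'' : (BoundaryManifold.boundaryData 3 W).incl (g u') ∈
        (chartAt (EuclideanHalfSpace 4) ((BoundaryManifold.boundaryData 3 W).incl (g u))).source := hu'
    have h0 : (chartAt (EuclideanHalfSpace 4) ((BoundaryManifold.boundaryData 3 W).incl (g u))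
        ((BoundaryManifold.boundaryData 3 W).incl (g u'))).val 0 = 0 :=
      (mem_boundary_iff_of_mem_atlas (chart_mem_atlas _ _) hu'').1
        ((BoundaryManifold.boundaryData 3 W).incl_mem_boundary _)
    have h1 : (extChartAt (𝓡 3) (g u) ∘ g) u' =
        tail 3 (chartAt (EuclideanHalfSpace 4) ((BoundaryManifold.boundaryData 3 W).incl (g u))
          ((BoundaryManifold.boundaryData 3 W).incl (g u'))).val := rfl
    have h2 : extChartAt (𝓡∂ 4) ((BoundaryManifold.boundaryData 3 W).incl (g u))
        ((BoundaryManifold.boundaryData 3 W).incl (g u')) =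
        (chartAt (EuclideanHalfSpace 4) ((BoundaryManifold.boundaryData 3 W).incl (g u))
          ((BoundaryManifold.boundaryData 3 W).incl (g u'))).val := rfl
    rw [zero_add, h1, h2, L3_tail_of_apply_zero h0]
  have hev : ∀ᶠ u' in 𝓝 u, u' ∈ g ⁻¹' (chartAt (EuclideanSpace ℝ (Fin 3)) (g u)).source :=
    hUo.mem_nhds huU
  refine LegendrianDarboux.isImmersionAtOfComplement_through_chart_of_injective_mfderiv
    (p := (BoundaryManifold.boundaryData 3 W).incl (g u)) (y₀ := 0) rfl hUo huU hgcs hinj ?_ ?_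
  · filter_upwards [hev] with u' hu'
    rw [key u' hu']
    exact (extChartAt (𝓡∂ 4) _).map_source (by rw [extChartAt_source]; exact hu')
  · filter_upwards [hev] with u' hu'
    rw [key u' hu', (extChartAt (𝓡∂ 4) _).left_inv (by rw [extChartAt_source]; exact hu')]

/-- **The seam push of a knot in `∂X` is a knot in `∂W`** (lift to `∂X`, apply `G`, include).
[cite: Kosinski1993, VI §6] -/
theorem isBoundaryKnot_seamPush {K : sphere (0 : EuclideanSpace ℝ (Fin 2)) 1 → X} (hK : IsBoundaryKnot K) :
    IsBoundaryKnot fun u => (BoundaryManifold.boundaryData 3 W).incl (G (knotLift hK u)) where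
  isSmoothEmbedding := isSmoothEmbedding_incl_comp ((isSmoothEmbedding_knotLift hK).diffeomorph_comp G)
  isBoundaryPoint _ := (BoundaryManifold.boundaryData 3 W).incl_mem_boundary _

omit [T2Space X] in
/-- **The velocity of the pushed knot is the push of the velocity of the lifted knot.** [folklore] -/
theorem knotVelocity_seamPush {K : sphere (0 : EuclideanSpace ℝ (Fin 2)) 1 → X} (hK : IsBoundaryKnot K)
    (t : ℝ) :
    knotVelocity (fun u => (BoundaryManifold.boundaryData 3 W).incl (G (knotLift hK u))) t =
      mfderiv (𝓡 3) (𝓡∂ 4) (fun y => (BoundaryManifold.boundaryData 3 W).incl (G y))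
        (liftLoop hK t) (paramVel hK t) := by
  have hc : MDifferentiableAt 𝓘(ℝ, ℝ) (𝓡 3) (liftLoop hK) t :=
    ((contMDiff_liftLoop hK) t).mdifferentiableAt (by simp)
  unfold knotVelocity paramVel
  rw [show ((fun u => (BoundaryManifold.boundaryData 3 W).incl (G (knotLift hK u))) ∘ circlePt) =
      (fun y => (BoundaryManifold.boundaryData 3 W).incl (G y)) ∘ liftLoop hK from rfl,
    mfderiv_comp t ((contMDiff_seamPush G _).mdifferentiableAt (by simp)) hc]
  rfl

omit [T2Space X] in
/-- **The seam push of a framing is a framing**: `u ↦ d(G)(tail ν u)` along the pushed knot is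
continuous into `TW` (§1), tangent to `∂W`, and nowhere tangent to the pushed knot (the
differential of the seam push is injective and `ν` is nowhere tangent to `K`). [cite: Kosinski1993, VI §6] -/
theorem isKnotFraming_seamPush {K : sphere (0 : EuclideanSpace ℝ (Fin 2)) 1 → X} (hK : IsBoundaryKnot K)
    {ν : sphere (0 : EuclideanSpace ℝ (Fin 2)) 1 → EuclideanSpace ℝ (Fin 4)} (hν : IsKnotFraming K ν) :
    IsKnotFraming (fun u => (BoundaryManifold.boundaryData 3 W).incl (G (knotLift hK u))) fun u =>
      mfderiv (𝓡 3) (𝓡∂ 4) (fun y => (BoundaryManifold.boundaryData 3 W).incl (G y))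
        (knotLift hK u) (tail 3 (ν u)) where
  continuous := by
    rw [← continuousOn_univ]
    have h0 := hν.continuous.continuousOn (s := univ)
    have h1 := continuousOn_totalSpace_tail (G := knotLift hK) (σ := ν) (R := univ)
      (fun u _ => hν.mem_boundaryTangentSpace u) h0
    exact continuousOn_totalSpace_mfderiv (contMDiff_seamPush G) h1
  mem_boundaryTangentSpace u := (mem_boundaryTangentSpace_iff _).2 (mfderiv_seamPush_apply_zero G _ _)
  not_mem_span t := by
    rw [knotVelocity_seamPush, Submodule.mem_span_singleton]
    rintro ⟨c, hc⟩
    have hc' : mfderiv (𝓡 3) (𝓡∂ 4) (fun y => (BoundaryManifold.boundaryData 3 W).incl (G y))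
        (liftLoop hK t) (c • paramVel hK t) =
        mfderiv (𝓡 3) (𝓡∂ 4) (fun y => (BoundaryManifold.boundaryData 3 W).incl (G y))
          (liftLoop hK t) (tail 3 (ν (circlePt t))) :=
      ((mfderiv (𝓡 3) (𝓡∂ 4) (fun y => (BoundaryManifold.boundaryData 3 W).incl (G y))
        (liftLoop hK t)).map_smul c (paramVel hK t)).trans hc
    have h1 : c • paramVel hK t = tail 3 (ν (circlePt t)) := injective_mfderiv_seamPush G _ hc'
    apply hν.not_mem_span t
    rw [Submodule.mem_span_singleton]
    refine ⟨c, ?_⟩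
    calc c • knotVelocity K t = c • consZeroL 3 (paramVel hK t) := by
          rw [knotVelocity_eq_consZeroL_paramVel hK]
      _ = consZeroL 3 (c • paramVel hK t) := ((consZeroL 3).map_smul c (paramVel hK t)).symm
      _ = consZeroL 3 (tail 3 (ν (circlePt t))) := by rw [h1]
      _ = ν (circlePt t) := consZeroL_tailFraming hν (circlePt t)

/-- **Sub-goal `helper_isKnotFraming_seamPush` of stub `stub_steinRealisation`** (NF6 ▸ T3 ▸ T3c-3,
brick (b) part 1; wave 3, lead c5): **the seam push of a framed knot of `∂X` is a framed knot of
`∂W`.**  For a diffeomorphism `G : ∂X ≅ ∂W` of the canonical boundary carriers, a knot `K` in `∂X`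
(`IsBoundaryKnot`) and a framing `ν` of `K` in `∂X` (`IsKnotFraming`): the pushed knot
`u ↦ (G (K u) : W)` is a knot in `∂W` and `u ↦ d(G)(tail (ν u))` (push by the differential of
`y ↦ (G y : W)` of the tail of `ν`, `ν = (0, tail ν)` being tangent to `∂X`) is a framing of it in
`∂W`. [cite: Kosinski1993, VI §6] -/
theorem helper_isKnotFraming_seamPush : ∀ {X : Type} [TopologicalSpace X] [T2Space X] [ChartedSpace (EuclideanHalfSpace 4) X] [IsManifold (𝓡∂ 4) ∞ X] {W : Type} [TopologicalSpace W] [ChartedSpace (EuclideanHalfSpace 4) W] [IsManifold (𝓡∂ 4) ∞ W] (G : (Literature.Topology.FourManifolds.BoundaryManifold.boundaryData 3 X).carrier ≃ₘ⟮𝓡 3, 𝓡 3⟯ (Literature.Topology.FourManifolds.BoundaryManifold.boundaryData 3 W).carrier) (K : Metric.sphere (0 : EuclideanSpace ℝ (Fin 2)) 1 → X) (hK : Literature.Geometry.Symplectic.IsBoundaryKnot K) (ν : Metric.sphere (0 : EuclideanSpace ℝ (Fin 2)) 1 → EuclideanSpace ℝ (Fin 4)), Literature.Geometry.Symplectic.IsKnotFraming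 K ν → Literature.Geometry.Symplectic.IsBoundaryKnot (fun u => (Literature.Topology.FourManifolds.BoundaryManifold.boundaryData 3 W).incl (G (Literature.Geometry.Symplectic.knotLift hK u))) ∧ Literature.Geometry.Symplectic.IsKnotFraming (fun u => (Literature.Topology.FourManifolds.BoundaryManifold.boundaryData 3 W).incl (G (Literature.Geometry.Symplectic.knotLift hK u))) (fun u => mfderiv (𝓡 3) (𝓡∂ 4) (fun y => (Literature.Topology.FourManifolds.BoundaryManifold.boundaryData 3 W).incl (G y)) (Literature.Geometry.Symplectic.knotLift hK u) (Literature.Topology.FourManifolds.BoundaryManifold.tail 3 (ν u))) :=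
  fun G _ hK _ hν => ⟨isBoundaryKnot_seamPush G hK, isKnotFraming_seamPush G hK hν⟩

end SeamPush

end Summit.SmoothPoincare4.SmoothPoincare4.Theorems.AcyclicBisectionExists.ModpBraidOrbits

end
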